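/-
Copyright (c) 2026 the pub-hodgecm-mathlib formalisation cell (harness21).  Prover seat hodgecm-mathlib-LH4-p01 (g11): half-A line LH4, organ (L2-6)-dy «2-deep representatives of the
charged type-(2) classes at EVERY unramified inert place, BY COUNTING» — the 2-free twin of ★ `TwoDeepRepresentativesTypeTwo` (F0P3a-p01); 2026-09-03.
-/
import Literature.NumberTheory.Rogawski1990.DepthZeroKappaTransferTypeTwoLevelTwoEisenstein        -- (B2h) (this seat): `ncard_levelTwo_eq_phiTHn ∕ _phiTHprimen_of_eisensteinData_…` (over (B2g), (B2f), (W2))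
import Literature.NumberTheory.Rogawski1990.UnitOrbitalIntegralInertClosedFormsTypeTwoPositivity   -- (B2p) (this seat): `phiTHn_pos`, `phiTHprimen_pos`
import Literature.NumberTheory.Rogawski1990.TwoDeepRepresentativesTypeTwo                         -- ★ the tame organ (statement twinned here; brings `finExplicitCollection`, `…_conj_left∕right_all`, `toPlace_uniformizer_ne_zero`)
import Literature.NumberTheory.Rogawski1990.TypeTwoEisensteinDataAtPlace                          -- ★ (P2d-α) p853493 (LH10-p01): `exists_eisensteinData_at_place`
import Literature.NumberTheory.Rogawski1990.DepthZeroKappaTransferTypeTwoGSide                     -- ★ `forall_valuation_coeff_charpoly_sub_lt_one_of_isLocalNormPair`, `setOf_entrywise_deep_mem_nhds_one`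
import Literature.NumberTheory.Rogawski1990.DepthZeroKappaTransferTypeTwo                          -- ★ the tame (P-2) clause's near-1 package: `setOf_residuallyUnipotent_endoEmbLocal_mem_nhds_one`, `v_charpoly_coeff_le_one_of_residuallyUnipotent`, …
import Literature.NumberTheory.Automorphic.AdicCompletionResidueCard                               -- ★ `natCard_valuativeResidueField_adicCompletion_eq` (`q_v ≥ 2`)
import HarnessLib

/-!
# 2-deep `K`-representatives of the charged type-(2) classes near the identity at EVERY unramified inert place (`|2|_w = 1` deleted), by counting

Topic `NumberTheory/Rogawski1990`; namespace `Literature.NumberTheory.Rogawski1990`.  THEOREMS ONLY (no `def`, no instance, no notation, no named fact, no `sorry`); kernel lane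
`--supports stmt-HodgeConjecture-24833`.  Cell `pub/hodgecm-mathlib` (D-0151), crux H413 = `stmt-HodgeConjecture-24833`; half-A line LH4, organ **(L2-6)-dy** of the dyadic rider
`stub_N6nsDyadic`: the rider `stub_twoDeepRep_typeTwo` of LIFT 1 → 2 with the hypothesis `h2 : IsUnit (2 : 𝒪_w)` DELETED.  HONEST LABEL: HC_CM is proved only modulo the 7 printed
citations (2 remaining named inputs: hLiu418 = stmt-HodgeConjecture-24832, h413 = stmt-HodgeConjecture-24833) until rung 0 closes; count-neutral Literature theorem (no label
movement until the desk prices the rider; the level-two wall (L2-3) is NOT touched by this file).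

THE STATEMENT (`exists_twoDeepRepresentative_of_finExplicitDelta_ne_zero_typeTwo_of_isUnramifiedIn`) = ★ `exists_twoDeepRepresentative_of_finExplicitDelta_ne_zero_typeTwo`
(`TwoDeepRepresentativesTypeTwo.lean` :311) with the ONE binder `(h2 : IsUnit (2 : 𝒪[w.1.adicCompletion L]))` deleted, conclusion byte-identical: at a finite place `v` of `L⁺`
NON-SPLIT and UNRAMIFIED in the CM field `L` (`w ∣ v`, `c • w = w`), ANY residue characteristic, of good reduction for the hermitian `H′`, there is a neighbourhood `V` of
`1 ∈ H_v` such that for every `G`-regular `γ_H ∈ V` of TYPE (2) and every conjugacy class `c` of `G′_v` charged by `Δ‴_v(γ_H, ·)` (and meeting `K′`), `c` has a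
representative `γ₀ ∈ K′` with `(γ₀)_w ≡ 1 (mod ϖ_v²)` in the coordinates of `H′`.

THE PROOF (no square-root generator, no `2`).  `V` = residually-unipotent `ι_v(γ_H)` ∩ the 3-deep box `{|g_w − 1|, |u_w − 1| ≤ |ϖ_v|³}` (★; at depth 2 the `κ = −1` class can
miss `K′(2)` — Flicker's `Φ′` vanishes at `M = 0`).  A charged class `c` is a MATCH: `δ := out c` has `Δ‴ ≠ 0 ⇒ ι_v(γ_H) ↔ δ` (★ support) and `κ_v(γ_H, δ) = ±1` (unfolding);
`δ_w` is residually unipotent (★ `forall_valuation_coeff_charpoly_sub_lt_one_of_isLocalNormPair`).  ★ (P2d-α) gives Eisenstein data `(Θ, α, β, a, b, n, N)` of `(g_w, u_w)` at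
`ϖ_v`, with `n ≤ 2N + 1`; 3-deep ⇒ `|χ_{g_w}(u_w)| ≤ |ϖ_v|⁶ ⇒ n ≥ 6 ⇒ N ≥ 3`.  (B2h): the number of `δ`-fixed cosets `q ∈ G′_v ⧸ K′` with `(q⁻¹δq)_w ≡ 1 (mod ϖ_v²)` is
`Φ_{n−4}(N−2)` (`κ = 1`) ∕ `Φ′_{n−4}(N−2)` (`κ = −1`), `q_v = #𝓀(L⁺_v) ≥ 2`, and both are `> 0` at `n − 4 ≥ 2` ((B2p)); a fixed level-two coset `q` gives `γ₀ := q⁻¹δq ∈ K′`,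
`⟦γ₀⟧ = ⟦δ⟧ = c`, `(γ₀)_w ≡ 1 (mod ϖ_v²)`. [cite: Rogawski1990, §4.9 Prop. 4.9.1 (b) p. 55, Lemma 4.9.3 p. 56; §4.3 p. 43] [cite: Flicker1998UnitaryFL, Prop. 11 p. 87, Props. 16–17 pp. 96–97, Theorem 18 p. 97]
[cite: Kottwitz1986BaseChangeUnits, §1 pp. 240–241]

## References
* [Rogawski1990] J. D. Rogawski, *Automorphic Representations of Unitary Groups in Three Variables*, Ann. of Math. Stud. 123 (1990): §4.3 p. 43, §4.9 Prop. 4.9.1 (b) p. 55, Lemma 4.9.3 p. 56.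
* [Flicker1998UnitaryFL] Y. Z. Flicker, *Elementary proof of the fundamental lemma for a unitary group*, Canad. J. Math. 50 (1998): Prop. 11 p. 87, Props. 16–17 pp. 96–97, Theorem 18 p. 97.
* [Kottwitz1986BaseChangeUnits] R. E. Kottwitz, *Base change for unit elements of Hecke algebras*, Compositio Math. 60 (1986): §1 pp. 240–241.
-/

set_option autoImplicit false

noncomputable section

open NumberField IsDedekindDomain Matrix Polynomial Topology Filter
open Literature.NumberTheory.Automorphic Literature.NumberTheory.Automorphic.UnitaryGroup
open Literature.NumberTheory.Automorphic.IntegralReduction Literature.NumberTheory.GaloisRepresentations Literature.NumberTheory.Automorphic.UnitaryLatticeTree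
open Literature.NumberTheory.Rogawski1990.Flicker1998 (phiTHn phiTHprimen phiTHn_pos phiTHprimen_pos)
open scoped Matrix MatrixGroups ValuativeRel

namespace Literature.NumberTheory.Rogawski1990

/-! ## §1 Two elementary readings -/

/-- **`|χ_g(u)| ≤ |c|²` on the `c`-deep box**: if `|(g − 1)ᵢⱼ| ≤ |c|` and `|u − 1| ≤ |c|` then `|u² − tr g·u + det g| ≤ |c|²`
(`u² − tr g·u + det g = det(u•1 − g)` is a quadratic form in the five small quantities without terms of degree `< 2`). [cite: Rogawski1990, §4.9 p. 55] -/
theorem v_quadratic_le_sq_of_entrywise_deep {K : Type*} [Field K] [Valued K (WithZero (Multiplicative ℤ))] (g : Matrix (Fin 2) (Fin 2) K) (u c : K)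
    (hg : ∀ i j, Valued.v ((g - 1) i j) ≤ Valued.v c) (hu : Valued.v (u - 1) ≤ Valued.v c) :
    Valued.v (u ^ 2 - g.trace * u + g.det) ≤ Valued.v c ^ 2 := by
  have e : u ^ 2 - g.trace * u + g.det = ((u - 1) - (g - 1) 0 0) * ((u - 1) - (g - 1) 1 1) - (g - 1) 0 1 * (g - 1) 1 0 := by
    simp only [Matrix.trace_fin_two, Matrix.det_fin_two, Matrix.sub_apply, Matrix.one_apply_eq, Matrix.one_apply_ne (by decide : (0 : Fin 2) ≠ 1),
      Matrix.one_apply_ne (by decide : (1 : Fin 2) ≠ 0)]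
    ring
  rw [e, sq]
  refine (Valuation.map_sub _ _ _).trans (max_le ?_ ?_)
  · rw [map_mul]
    exact mul_le_mul' ((Valuation.map_sub _ _ _).trans (max_le hu (hg 0 0))) ((Valuation.map_sub _ _ _).trans (max_le hu (hg 1 1)))
  · rw [map_mul]
    exact mul_le_mul' (hg 0 1) (hg 1 0)

/-- **`κ_v = ±1` on the support of `Δ‴_v`** (unfolding: `Δ‴_v = τ_v·D_v·κ_v` on a match and `κ_v ∈ {0, 1, −1}`, `κ_v = 0` exactly off the support of `P_v`).
[cite: Rogawski1990, §14.6 p. 242; §4.3 p. 43] -/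
theorem finKappaAt_eq_one_or_eq_neg_one_of_finExplicitDelta_ne_zero (L : Type) [Field L] [NumberField L] [IsCMField L] (H' : Matrix (Fin 3) (Fin 3) L)
    (μ : HeckeCharacter L) {v : HeightOneSpectrum (𝓞 ↥(maximalRealSubfield L))}
    (γH : (cmDatum L 2 (Matrix.of fun i j : Fin 2 => if i.val + j.val + 1 = 2 then (1 : L) else 0)).Local v ×
      (cmDatum L 1 (Matrix.of fun i j : Fin 1 => if i.val + j.val + 1 = 1 then (1 : L) else 0)).Local v)
    {δ : (cmDatum L 3 H').Local v} (hΔ : finExplicitDelta L v H' γH μ δ ≠ 0) :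
    IsLocalNormPair L H' v γH δ ∧ (finKappaAt L v H' γH δ = 1 ∨ finKappaAt L v H' γH δ = -1) := by
  classical
  have h : IsLocalNormPair L H' v γH δ := by
    by_contra hn
    exact hΔ (finExplicitDelta_of_not_isLocalNormPair L v H' γH μ hn)
  refine ⟨h, ?_⟩
  have hκ0 : finKappaAt L v H' γH δ ≠ 0 := by
    intro h0
    apply hΔ
    rw [finExplicitDelta_of_isLocalNormPair L v H' γH μ h, h0, Int.cast_zero, mul_zero]
  have hP : finEigenlineProjector L v H' γH δ ≠ 0 := fun hP => hκ0 (finKappaAt_of_projector_eq_zero L v H' γH hP)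
  unfold finKappaAt
  rw [if_neg hP]
  split_ifs <;> decide

/-! ## §2 The organ (L2-6)-dy -/

set_option maxHeartbeats 800000 in
-- the strata set of (B2h) and the class-quotient bookkeeping are large terms (★ (B2e) ∕ tame organ budgets)
open scoped Classical in
/-- **RIDER (H2D)-dy, TYPE (2) «2-DEEP REPRESENTATIVES» AT EVERY UNRAMIFIED INERT PLACE** = ★ `exists_twoDeepRepresentative_of_finExplicitDelta_ne_zero_typeTwo` with `h2` DELETED:
near `1 ∈ H_v`, at type-(2) `G`-regular `γ_H` (`χ_{g_w}` rootless), every `G′_v`-class `c` with `Δ‴_v(γ_H, out c) ≠ 0` meeting `K′` has a representative `γ₀ ∈ K′` with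
`(γ₀)_w ≡ 1 (mod ϖ_v²)` in the coordinates of `H′`.  `V` = residually unipotent ∩ 3-deep box; proof BY COUNTING over (B2h) + (B2p) (module docstring).  (The hypotheses
`IsLocalGRegular`, `hμ`, `hμu`, `hμω` and «`c` meets `K′`» are not needed.) [cite: Rogawski1990, §4.9 Prop. 4.9.1 (b) p. 55, Lemma 4.9.3 p. 56; §4.3 p. 43]
[cite: Flicker1998UnitaryFL, Prop. 11 p. 87, Props. 16–17 pp. 96–97, Theorem 18 p. 97] [cite: Kottwitz1986BaseChangeUnits, §1 pp. 240–241] -/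
theorem exists_twoDeepRepresentative_of_finExplicitDelta_ne_zero_typeTwo_of_isUnramifiedIn
    (L : Type) [Field L] [NumberField L] [IsCMField L] (H' : Matrix (Fin 3) (Fin 3) L) (μ : HeckeCharacter L)
    {v : HeightOneSpectrum (𝓞 ↥(maximalRealSubfield L))}
    (hH' : (H'.map (cmConjRingHom L)).transpose = H') (w : PlacesOver L v)
    (hw : IsCMField.complexConj L • w.1 = w.1) (hv : Algebra.IsUnramifiedIn (𝓞 L) v.asIdeal)
    (hH'w : IsUnit (placeForm H' w.1)) (hH'i : hH'w.unit ∈ glInt 3 (w.1.adicCompletion L))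
    (_hμ : μ.IsUnramifiedAt w.1) (_hμu : μ.IsUnitary)
    (_hμω : ∀ x : ideleGroup ↥(maximalRealSubfield L), μ (AdeleRing.ideleBaseChange ↥(maximalRealSubfield L) L x) = quadraticHeckeCharCM L x) :
    ∃ V ∈ 𝓝 (1 : ((cmDatum L 2 (Matrix.of fun i j : Fin 2 => if i.val + j.val + 1 = 2 then (1 : L) else 0)).Local v × (cmDatum L 1 (Matrix.of fun i j : Fin 1 => if i.val + j.val + 1 = 1 then (1 : L) else 0)).Local v)), ∀ γH ∈ V, IsLocalGRegular L v γH →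
      ¬ (∃ x : w.1.adicCompletion L, (((γH.1.val : GL (Fin 2) (UnitaryGroup.LocalRing L v)).val.map
          (Pi.evalRingHom (fun w' : PlacesOver L v => w'.1.adicCompletion L) w)).charpoly).IsRoot x) →
      (∀ cG : ConjClasses ((cmDatum L 3 H').Local v),
          ((finExplicitCollection L H' μ (finExplicitDelta_conj_left_all L H' μ) (finExplicitDelta_conj_right_all L H' μ)) v).Δ γH (Quotient.out cG) ≠ 0 →
          (∃ z ∈ cmLocalIntegralLevel L 3 H' v, ConjClasses.mk z = cG) →
          ∃ γ₀ : ((cmDatum L 3 H').Local v), ConjClasses.mk γ₀ = cG ∧ γ₀ ∈ cmLocalIntegralLevel L 3 H' v ∧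
            (∀ a b, Valued.v (((toPlace v w (HeckeCharacter.uniformizer ↥(maximalRealSubfield L) v : v.adicCompletion ↥(maximalRealSubfield L))) ^ 2)⁻¹ *
        ((((localNonsplitEquiv (IsCMField.complexConj L) H' (IsCMField.complexConj_ne_one L) w hw (γ₀) :
            ↥(unitaryGroupOfForm (galAdicCompletionMap (L := L) (IsCMField.complexConj L) hw) (placeForm H' w.1))) : GL (Fin 3) (w.1.adicCompletion L)) :
              Matrix (Fin 3) (Fin 3) (w.1.adicCompletion L)) a b - (1 : Matrix (Fin 3) (Fin 3) (w.1.adicCompletion L)) a b)) ≤ 1)) := by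
  classical
  have hH'σ : (H'.map (IsCMField.complexConj L))ᵀ = H' := hH'
  -- `H′` is invertible: its image over `L_w` is
  have hH'u : IsUnit H' := by
    rw [Matrix.isUnit_iff_isUnit_det]
    have h := (Matrix.isUnit_iff_isUnit_det _).1 hH'w
    rw [show placeForm H' w.1 = (algebraMap L (w.1.adicCompletion L)).mapMatrix H' from rfl, ← RingHom.map_det] at h
    exact isUnit_iff_ne_zero.2 fun h0 => h.ne_zero (by rw [h0, map_zero])
  -- the uniformizer `ϖ_v` read at `w` (`|ϖ|_w = q⁻¹`, `v` unramified in `L`) and `q_v ≥ 2`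
  have hϖ1 := Liu2021.LemD1IndexedNonVacuityInertCofinite.valued_toPlace_uniformizer_of_isUnramifiedIn L v hv w
  have hϖ0 : (toPlace v w (HeckeCharacter.uniformizer ↥(maximalRealSubfield L) v : v.adicCompletion ↥(maximalRealSubfield L))) ≠ 0 :=
    fun h0 => by rw [h0, map_zero] at hϖ1; exact WithZero.zero_ne_coe hϖ1
  have hq : 2 ≤ Nat.card 𝓀[v.adicCompletion ↥(maximalRealSubfield L)] := by
    rw [natCard_valuativeResidueField_adicCompletion_eq]; exact v.one_lt_residueCard
  -- (0) the neighbourhood: residually unipotent `ι_v(γ_H)` ∩ the 3-deep box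
  have hc3 : (toPlace v w (HeckeCharacter.uniformizer ↥(maximalRealSubfield L) v : v.adicCompletion ↥(maximalRealSubfield L))) ^ 3 ≠ 0 := pow_ne_zero 3 hϖ0
  refine ⟨_ ∩ _, Filter.inter_mem (setOf_residuallyUnipotent_endoEmbLocal_mem_nhds_one L v w) (setOf_entrywise_deep_mem_nhds_one L v w hc3), ?_⟩
  intro γH hγV _hreg hirr cG hΔ _hK
  obtain ⟨hγ0, hγ3⟩ := hγV
  simp only [Set.mem_setOf_eq] at hγ0 hγ3
  have h32 : Valued.v ((toPlace v w (HeckeCharacter.uniformizer ↥(maximalRealSubfield L) v : v.adicCompletion ↥(maximalRealSubfield L))) ^ 3) ≤ WithZero.exp (-2 : ℤ) := by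
    rw [map_pow, hϖ1, ← WithZero.exp_nsmul, WithZero.exp_le_exp]; norm_num
  have hg2 : ∀ i j, Valued.v ((((γH.1.val : GL (Fin 2) (LocalRing L v)).val.map (Pi.evalRingHom (fun w' : PlacesOver L v => w'.1.adicCompletion L) w)) - 1) i j) ≤
      WithZero.exp (-2 : ℤ) := fun i j => (hγ3.1 i j).trans h32
  have hu2 : Valued.v (finGammaTwo L v γH w - 1) ≤ WithZero.exp (-2 : ℤ) := hγ3.2.trans h32
  -- (1) the class is a match, `κ = ±1`, `δ_w` residually unipotent
  have hΔ' : finExplicitDelta L v H' γH μ (Quotient.out cG) ≠ 0 := by rwa [finExplicitCollection_Δ] at hΔ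
  obtain ⟨h, hκ⟩ := finKappaAt_eq_one_or_eq_neg_one_of_finExplicitDelta_ne_zero L H' μ γH hΔ'
  have ht := forall_valuation_coeff_charpoly_sub_lt_one_of_isLocalNormPair L H' w hγ0 h
  -- (2) the Eisenstein data at `w` (★ (P2d-α)); integrality of `tr g_w`, `det g_w`, `u_w` from residual unipotence
  have hintV : ∀ i : ℕ, ((((endoEmbLocal L v γH).val : GL (Fin 3) (UnitaryGroup.LocalRing L v)).val.map
      (Pi.evalRingHom (fun w' : PlacesOver L v => w'.1.adicCompletion L) w)).charpoly.coeff i) ∈ Valued.integer (w.1.adicCompletion L) :=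
    fun i => (Valuation.mem_integer_iff _ _).2 (v_charpoly_coeff_le_one_of_residuallyUnipotent _ hγ0 i)
  obtain ⟨htrg, hδ⟩ := valued_trace_le_one_and_valued_det_le_one_of_hint L v w hw (a := γH) hintV
  have hu : Valued.v (finGammaTwo L v γH w) ≤ 1 := (valued_finGammaTwo_apply_eq_one L v w hw (a := γH)).le
  obtain ⟨Θ, α, β, a₁, b₁, n, N, hΘ, hΘd, hΘt, hrel, hn, hb, hnN, -⟩ := exists_eisensteinData_at_place L w hw hv hirr htrg hδ hu hϖ1
  -- (3) the guards: 3-deep ⇒ `|χ_{g_w}(u_w)| ≤ |ϖ|⁶ ⇒ n ≥ 6`, and `n ≤ 2N + 1 ⇒ N ≥ 3`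
  have hχ := v_quadratic_le_sq_of_entrywise_deep _ _ _ hγ3.1 hγ3.2
  have hn6 : 6 ≤ n := by
    rw [← eval_finCharpolyTwo_finGammaTwo_apply_eq_quadratic, hn, map_pow, hϖ1, ← pow_mul, ← WithZero.exp_nsmul, WithZero.exp_le_exp] at hχ
    norm_num at hχ
    omega
  have hn4 : 4 ≤ n := by omega
  have hN2 : 2 ≤ N := by omega
  -- (4) the level-two coset count of the class is positive ((B2h) values, (B2p) positivity)
  have hpos : (0 : ℚ) < (({q : (cmDatum L 3 H').Local v ⧸ cmLocalIntegralLevel L 3 H' v |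
      q ∈ MulAction.fixedBy ((cmDatum L 3 H').Local v ⧸ cmLocalIntegralLevel L 3 H' v) (Quotient.out cG) ∧
        IsIntMatrix (((toPlace v w (HeckeCharacter.uniformizer ↥(maximalRealSubfield L) v : v.adicCompletion ↥(maximalRealSubfield L))) ^ 2)⁻¹ •
          ((((q.out⁻¹ * Quotient.out cG * q.out : (cmDatum L 3 H').Local v)).val : GL (Fin 3) (LocalRing L v)).val.map
            (Pi.evalRingHom (fun w' : UnitaryGroup.PlacesOver L v => w'.1.adicCompletion L) w) - 1))}.ncard : ℕ) : ℚ) := by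
    rcases hκ with hκ | hκ
    · rw [ncard_levelTwo_eq_phiTHn_of_eisensteinData_of_finKappaAt_eq_one hH'σ w hw hv hH'w hH'i hH'u hirr (Quotient.out cG) h ht hϖ1 hΘ hΘd hΘt hrel n N hn hb
        hg2 hu2 hn4 hN2 hκ]
      exact phiTHn_pos hq _ _
    · rw [ncard_levelTwo_eq_phiTHprimen_of_eisensteinData_of_finKappaAt_eq_neg_one hH'σ w hw hv hH'w hH'i hH'u hirr (Quotient.out cG) h ht hϖ1 hΘ hΘd hΘt hrel n N hn hb
        hg2 hu2 hn4 hN2 hκ]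
      exact phiTHprimen_pos hq (by omega) _
  obtain ⟨q, hqfix, hqlev⟩ := Set.nonempty_of_ncard_ne_zero (by exact_mod_cast hpos.ne' :
    ({q : (cmDatum L 3 H').Local v ⧸ cmLocalIntegralLevel L 3 H' v |
      q ∈ MulAction.fixedBy ((cmDatum L 3 H').Local v ⧸ cmLocalIntegralLevel L 3 H' v) (Quotient.out cG) ∧
        IsIntMatrix (((toPlace v w (HeckeCharacter.uniformizer ↥(maximalRealSubfield L) v : v.adicCompletion ↥(maximalRealSubfield L))) ^ 2)⁻¹ •
          ((((q.out⁻¹ * Quotient.out cG * q.out : (cmDatum L 3 H').Local v)).val : GL (Fin 3) (LocalRing L v)).val.map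
            (Pi.evalRingHom (fun w' : UnitaryGroup.PlacesOver L v => w'.1.adicCompletion L) w) - 1))}.ncard ≠ 0))
  -- (5) the representative `γ₀ := q⁻¹ δ q`
  refine ⟨q.out⁻¹ * Quotient.out cG * q.out, ?_, ?_, fun i j => ?_⟩
  · have e1 : ConjClasses.mk (q.out⁻¹ * Quotient.out cG * q.out) = ConjClasses.mk (Quotient.out cG) :=
      ConjClasses.mk_eq_mk_iff_isConj.2 (isConj_iff.2 ⟨q.out, by group⟩)
    rw [e1, ← ConjClasses.quotient_mk_eq_mk, Quotient.out_eq]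
  · rw [← QuotientGroup.out_eq' q] at hqfix
    exact (mem_fixedBy_quotient_mk_iff (cmLocalIntegralLevel L 3 H' v) (Quotient.out cG) q.out).1 hqfix
  · have hij := hqlev i j
    rw [Matrix.smul_apply, smul_eq_mul, Matrix.sub_apply] at hij
    exact hij

end Literature.NumberTheory.Rogawski1990

end
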